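import Summits.Ventures.DiscreteObjects.PP12.FlagExterior

/-!
# PP(12), flag cells: two exterior orbit-triangles are never mutually inscribed
Framing: lottery ticket; floor = certified bounds/negative ranges.

Cell pub-namedobj (venture DiscreteObjects), target (M), designs gen 12. For a collineation `σ` with `σ³ = 1` and an exterior point `Q`
(on no fixed line) the orbit `{Q, σQ, σ²Q}` is a triangle whose sides are exterior lines, and every exterior line is a side of exactly one
orbit-triangle (`FlagExterior.orbit_triangle`, `side_unique`). If a point `R` of another exterior orbit lies on the side `Q·σQ` ('triangle
of `R` has a vertex on a side of the triangle of `Q`'), then NO point of the orbit of `Q` lies on the side `R·σR`: two orbit-triangles are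
never mutually inscribed (`not_mutually_inscribed`). At the orbit level this is the statement that the odd-point map `ψ` (f = 10: the
permutation `φ⁻¹` of the Latin-square / orbit-matrix reduction; general flag type: the map `ψ` of designs g12 FAMILY-FLAG7 §1) has NO
2-CYCLE — the hypothesis under which `K₁₂ − C_φ` has 54 edges in FAMILY-FLAG10 §3 / `IsFlagTenOrbitMatrix`. It was so far in the kernel
only as a consequence of the TYPED Latin-square property (`IsFlagTenLatinSquare.phi_fpf`); here it is proved at the plane level, for any
number of fixed points and any order, from `side_unique` alone (three short cases; not even `σ³ = 1` is needed). No `sorry`, no new axioms.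
-/

namespace Summit.Ventures.DiscreteObjects.PP12

open Configuration Finset
open scoped Classical

namespace Collineation

variable {P L : Type*} [Membership P L] [ProjectivePlane P L] [Fintype P] [Fintype L]
  [DecidableEq P] [DecidableEq L] (σ : Collineation P L)

omit [ProjectivePlane P L] [Fintype P] [Fintype L] [DecidableEq P] [DecidableEq L] in
/-- The image of an exterior point is exterior (a fixed line containing `σQ` contains `Q`). -/
theorem exterior_map {Q : P} (hQX : ∀ m : L, σ.onLines m = m → Q ∉ m) :
    ∀ m : L, σ.onLines m = m → σ.onPoints Q ∉ m := by
  intro m hm h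
  have h' : σ.onPoints Q ∈ σ.onLines m := by rw [hm]; exact h
  exact hQX m hm ((σ.mem_iff Q m).1 h')

omit [Fintype P] [Fintype L] [DecidableEq P] [DecidableEq L] in
/-- **No mutual inscription.** Let `Q` lie on no fixed line, `a` a line through `Q` and `σQ` (a side of the orbit of `Q`), and
`R ∈ a` with `R ≠ Q, σQ`. If `b` is a line through `R` and `σR` (a side of the orbit of `R`), then `b` contains none of `Q, σQ, σ²Q`.
(No hypothesis on the order of `σ` or of the plane is needed.) (Cases `Q ∈ b` or `σQ ∈ b`: then `a = b` carries `Q, σQ, R, σR`, contradicting `side_unique`; case `σ²Q ∈ b`: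
then `b` and `σa` share `σR` and `σ²Q`, so `b = σa ∋ σQ`, and `b` carries `σQ, σ²Q, R, σR` — `side_unique` again.) -/
theorem not_mutually_inscribed {Q R : P}
    (hQX : ∀ m : L, σ.onLines m = m → Q ∉ m) {a : L} (hQa : Q ∈ a) (hσQa : σ.onPoints Q ∈ a) (hRa : R ∈ a)
    (hRQ : R ≠ Q) (hRσQ : R ≠ σ.onPoints Q)
    {b : L} (hRb : R ∈ b) (hσRb : σ.onPoints R ∈ b) :
    Q ∉ b ∧ σ.onPoints Q ∉ b ∧ σ.onPoints (σ.onPoints Q) ∉ b := by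
  have hσQX := σ.exterior_map hQX
  refine ⟨fun hQb => ?_, fun hσQb => ?_, fun hσσQb => ?_⟩
  · -- a and b share Q and R
    have hab : a = b := (Nondegenerate.eq_or_eq hQa hRa hQb hRb).resolve_left hRQ.symm
    subst hab
    exact hRQ (σ.side_unique hQX hQa hσQa hRa hσRb)
  · -- a and b share σQ and R
    have hab : a = b := (Nondegenerate.eq_or_eq hσQa hRa hσQb hRb).resolve_left hRσQ.symm
    subst hab
    exact hRQ (σ.side_unique hQX hQa hσQa hRa hσRb)
  · -- b and σa share σR and σ²Q
    have h1 : σ.onPoints R ∈ σ.onLines a := σ.mem_map hRa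
    have h2 : σ.onPoints (σ.onPoints Q) ∈ σ.onLines a := σ.mem_map hσQa
    have h3 : σ.onPoints Q ∈ σ.onLines a := σ.mem_map hQa
    have hne : σ.onPoints R ≠ σ.onPoints (σ.onPoints Q) := fun e => hRσQ (σ.onPoints.injective e)
    have hba : b = σ.onLines a := (Nondegenerate.eq_or_eq hσRb hσσQb h1 h2).resolve_left hne
    subst hba
    -- now σa carries σQ, σ(σQ) and R, σR: side_unique at the exterior point σQ
    have := σ.side_unique hσQX h3 h2 hRb hσRb
    exact hRσQ this

omit [Fintype P] [Fintype L] [DecidableEq P] [DecidableEq L] in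
/-- Corollary in the form used by the orbit-matrix reduction (`σ³ = 1`, so the orbit of `Q` is `{Q, σQ, σ²Q}`): if `R ≠ Q, σQ` lies on
the side `Q·σQ` and `S` lies on the side `R·σR`, then `S ∉ {Q, σQ, σ²Q}` — the odd-point map has no 2-cycle. -/
theorem oddPoint_no_two_cycle {Q R S : P}
    (hQX : ∀ m : L, σ.onLines m = m → Q ∉ m) {a : L} (hQa : Q ∈ a) (hσQa : σ.onPoints Q ∈ a) (hRa : R ∈ a)
    (hRQ : R ≠ Q) (hRσQ : R ≠ σ.onPoints Q)
    {b : L} (hRb : R ∈ b) (hσRb : σ.onPoints R ∈ b) (hSb : S ∈ b) :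
    S ≠ Q ∧ S ≠ σ.onPoints Q ∧ S ≠ σ.onPoints (σ.onPoints Q) := by
  obtain ⟨h1, h2, h3⟩ := σ.not_mutually_inscribed hQX hQa hσQa hRa hRQ hRσQ hRb hσRb
  exact ⟨fun e => h1 (e ▸ hSb), fun e => h2 (e ▸ hSb), fun e => h3 (e ▸ hSb)⟩

end Collineation

end Summit.Ventures.DiscreteObjects.PP12
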